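import Summits.Ventures.LatticeQCDFlow.Scoring.MeanSubtractedAcovCLT
import Summits.Ventures.LatticeQCDFlow.Scoring.MadrasSokalRatioCLT

/-!
# The `τ_int` CLT for the SCORERS' EXACT ESTIMATOR: `√N (τ̂^c_W − τ_W) ⇒ N(0, ℓᵀ Σ_c ℓ)` with `τ̂^c_W = ½ + Σ_{t≤W} Γ̂_c(t)/Γ̂_c(0)` (mean-subtracted, `1/(N−t)`)

HONEST FRAMING: exact (Metropolis-corrected) sampling algorithms for lattice gauge theory;
figures of merit are autocorrelation/cost numbers at stated couplings and volumes; no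
continuum-physics claim.

Venture `LatticeQCDFlow` (cell pub-lqcd), sub-topic `Scoring`; FANOUT row 16 (`su2-base`), GEN-8.
NEW WORK of the cell — the delta method (row 4's
`CardConsistency.tendstoInDistribution_deltaMethod_fderiv`, GEN-7's ratio map `tauHatFn` /
`hasFDerivAt_tauHatFn` / `tauHatDeriv_apply`) applied to GEN-8's joint CLT for the scorers' CENTRED,
`1/(N−t)`-normalised autocovariances (`MeanSubtractedAcovCLT.tendstoInDistribution_acovHatC`).
No definition; nothing cited as a fact.

GEN-7's `MadrasSokalRatioCLT.tendstoInDistribution_tauIntWindow` is the CLT for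
`½ + Σ Γ̂(t)/Γ̂(0)` with the KNOWN-MEAN, `1/N` statistic `Γ̂` of the packet.  What scorer A
(`gamma.py`) and scorer B (`scorer_b.py`) print is `tauIntWindow ρ̂_c W` with
`ρ̂_c(t) = Γ̂_c(t)/Γ̂_c(0)`, `Γ̂_c` the centred `1/(N−t)` estimator (GEN-6 `acovHatC`).  THIS FILE:

* **`tendstoInDistribution_tauIntWindow_acovHatC`** — `ξ` i.i.d., `X_i = F(ξ_i..ξ_{i+m})`, `X_0 ∈ L²`,
  centred lag products square integrable, `γ(0) = Var X_0 ≠ 0`; `Z` with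
  `⟪a, Z⟫ ~ N(0, aᵀ Σ_c a)`, `Σ_c = lagProdACov (X − μ) (m + W)` (Bartlett's covariance of the CENTRED
  process).  Then `√N (tauIntWindow ρ̂_c W − tauIntWindow ρ W) ⇒ ⟪∇τ(γ_vec), Z⟫`, `ρ(t) = γ(t)/γ(0)`:
  the scorers' printed statistic obeys the fixed-window CLT with the CENTRED-process covariance —
  the law GEN-6's `MadrasSokalErrorFormula` / `MadrasSokalRatioVariance` analyse.
  Its limit is `N(0, ℓᵀ Σ_c ℓ)` by GEN-7's `hasLaw_inner_tauHatGrad` (any covariance matrix).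

NOT CLAIMED: data-chosen `W` for the centred statistic (combine with `MadrasSokalDataWindow` as in
`MadrasSokalDataWindowCLT` once per-window consistency of `Γ̂_c` is recorded — it follows from
`MeanSubtractionCLT`, not typed here); second-order effects; Markov-chain data.
-/

noncomputable section

open MeasureTheory ProbabilityTheory Filter Finset WithLp
open scoped Topology ENNReal RealInnerProductSpace

namespace Summit.Ventures.LatticeQCDFlow.Scoring

section CLT

variable {Ω : Type*} [MeasurableSpace Ω] {P : Measure Ω} [IsProbabilityMeasure P]
variable {Ω' : Type*} [MeasurableSpace Ω'] {P' : Measure Ω'} [IsProbabilityMeasure P']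
variable {S : Type*} [MeasurableSpace S] {ξ : ℕ → Ω → S} {m : ℕ} {F : (Fin (m + 1) → S) → ℝ}

/-- **THE `τ_int` CLT FOR THE SCORERS' EXACT (centred, `1/(N−t)`) ESTIMATOR.**  `ξ` i.i.d.,
`X_i = F(ξ_i, …, ξ_{i+m})`, `X_0 ∈ L²`, `μ = E X_0`, centred lag products `(X_0 − μ)(X_t − μ)` square
integrable, `γ(t) = E[(X_0 − μ)(X_t − μ)]` with `γ(0) ≠ 0`, `Z` a random vector of `ℝ^{W+1}` with
`⟪a, Z⟫ ~ N(0, aᵀ Σ_c a)`, `Σ_c = lagProdACov (X − μ) (m + W)`.  Then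
`√N (tauIntWindow (Γ̂_c(·)/Γ̂_c(0)) W − tauIntWindow (γ(·)/γ(0)) W) ⇒ ⟪∇τ(γ_vec), Z⟫`. -/
theorem tendstoInDistribution_tauIntWindow_acovHatC (hξ : ∀ i, Measurable (ξ i))
    (hind : iIndepFun ξ P) (hid : ∀ i, IdentDistrib (ξ i) (ξ 0) P P) (hF : Measurable F)
    (h2 : MemLp (blockFactor F ξ 0) 2 P)
    (h4c : ∀ t, MemLp (fun ω => (blockFactor F ξ 0 ω - P[blockFactor F ξ 0])
      * (blockFactor F ξ t ω - P[blockFactor F ξ 0])) 2 P) (W : ℕ)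
    (hσ : P[fun ω => (blockFactor F ξ 0 ω - P[blockFactor F ξ 0])
      * (blockFactor F ξ 0 ω - P[blockFactor F ξ 0])] ≠ 0)
    {Z : Ω' → EuclideanSpace ℝ (Fin (W + 1))} (hZm : AEMeasurable Z P')
    (hZ : ∀ a : EuclideanSpace ℝ (Fin (W + 1)), HasLaw (fun ω' => ⟪a, Z ω'⟫) (gaussianReal 0
      (∑ s : Fin (W + 1), ∑ t : Fin (W + 1), a s * a t
        * lagProdACov (fun i ω => blockFactor F ξ i ω - P[blockFactor F ξ 0]) P (m + W) s t).toNNReal)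
      P') :
    TendstoInDistribution
      (fun (N : ℕ) ω => Real.sqrt N
        * (tauIntWindow (fun t => acovHatC (blockFactor F ξ) N t ω / acovHatC (blockFactor F ξ) N 0 ω) W
          - tauIntWindow (fun t => P[fun ω => (blockFactor F ξ 0 ω - P[blockFactor F ξ 0])
              * (blockFactor F ξ t ω - P[blockFactor F ξ 0])]
            / P[fun ω => (blockFactor F ξ 0 ω - P[blockFactor F ξ 0])
              * (blockFactor F ξ 0 ω - P[blockFactor F ξ 0])]) W))
      atTop (fun ω' => ⟪tauHatGrad W (toLp 2 fun t : Fin (W + 1) =>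
        P[fun ω => (blockFactor F ξ 0 ω - P[blockFactor F ξ 0])
          * (blockFactor F ξ t ω - P[blockFactor F ξ 0])]), Z ω'⟫) (fun _ => P) P' := by
  set μ : ℝ := P[blockFactor F ξ 0] with hμ
  set cvec : EuclideanSpace ℝ (Fin (W + 1)) := toLp 2 fun t : Fin (W + 1) =>
    P[fun ω => (blockFactor F ξ 0 ω - μ) * (blockFactor F ξ t ω - μ)] with hcvec
  set T : ℕ → Ω → EuclideanSpace ℝ (Fin (W + 1)) :=
    fun N ω => toLp 2 fun t : Fin (W + 1) => acovHatC (blockFactor F ξ) N t ω with hT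
  have hclt : TendstoInDistribution (fun (N : ℕ) ω => Real.sqrt N • (T N ω - cvec)) atTop Z
      (fun _ => P) P' :=
    tendstoInDistribution_acovHatC hξ hind hid hF h2 h4c W hZm hZ
  have hTm : ∀ N, AEMeasurable (T N) P := fun N =>
    ((WithLp.measurable_toLp 2 _).comp (measurable_pi_lambda _ fun t : Fin (W + 1) =>
      measurable_acovHatC (fun i => measurable_blockFactor hξ hF i) N t)).aemeasurable
  have hc0 : cvec 0 ≠ 0 := hσ
  have hD := CardConsistency.tendstoInDistribution_deltaMethod_fderiv
    (a := fun N : ℕ => Real.sqrt N) (Real.tendsto_sqrt_atTop.comp tendsto_natCast_atTop_atTop)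
    hclt hTm (hasFDerivAt_tauHatFn cvec hc0) (measurable_tauHatFn W)
  refine hD.congr (fun N => Eventually.of_forall fun ω => ?_) (Eventually.of_forall fun ω' => ?_)
  · rw [smul_eq_mul, hT, hcvec, tauHatFn_toLp (fun t => acovHatC (blockFactor F ξ) N t ω),
      tauHatFn_toLp (fun t => P[fun ω => (blockFactor F ξ 0 ω - μ) * (blockFactor F ξ t ω - μ)])]
  · exact tauHatDeriv_apply cvec (Z ω')

end CLT

end Summit.Ventures.LatticeQCDFlow.Scoring

end
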